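import Summits.Ventures.HodgeRepro2.T6N41PlaceKappaMain
import Summits.Ventures.HodgeRepro2.T6N41PlaceSplitToy

/-!
# T6N41PlaceKappaToy — non-vacuity witnesses for the (A″κ) layer (README §10.5(ii)(c)/(d))

Over the combined inert + split toy of T6N41PlaceSplitToy (`toyDatumIS`, `toyPlIS`, `toyInIS`, `toySpIS`,
`toyLQIS`): a convention-character datum `toyKdIS : KappaDatum toySpIS` modelled on the REAL place — `Fx v` and
`AddCh v` are the square classes of `ℝ^×` as Booleans (`false` = positive, `true` = negative; an additive
character `η = cψ` is recorded by the class of `c`; the class group's addition is `xor`), `smul c η = xor c η`,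
the Hilbert symbol `(a, c)_ℝ = −1` exactly when both are negative (`hilbert a c = sgn (a && c)`), the Weil-index
quotient `γF a η = sgn (a && η)`; the uniformiser and `t` are the negative class, `ψ` the positive one,
`λ_D(ϖ_w) = −1` and `κ_v(ϖ_v) = −1`.  On it every field of `KappaDatum` is PROVED — `μ₂_eq : 1 = (−1) · (−1)⁻¹` and
`γD_def : γ_D(𝔓₁) = 1 = (−1) · ((ϖ, t)_v)⁻¹` with `(ϖ, t)_v = sgn true = −1` (the toy's signs are all NON-trivial) —,
the display Rao Cor. A.5 (1) holds NON-VACUOUSLY for every `a`, `c`, `η` (`sgn (a && xor c η) = sgn (a && c) ·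
sgn (a && η)`, the multiplicativity of `sgn`), the residual `hκ'` holds (`κ_v = −1 = (γF ϖ ψ · (γF ϖ (tψ))⁻¹)⁻¹ =
(1 · (−1)⁻¹)⁻¹`), and the conclusions `κ_v(ϖ_v) = (ϖ_v, t)_v`, `γ_D(𝔓₁) = μ₂` and the placement identity at the
unramified places are obtained by applying the theorems: (c) `KappaDatum Sp` is instantiable, (d) the
hypotheses of `kappa_eq_hilbert` / `hκ_of_kappa` / `N41_placement_kappa` are jointly satisfiable.  No display
is closed by `trivial` / `simp` / `decide` / `exact ⟨⟩` on a general datum — the display's proof is the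
case analysis of `sgn` on the toy's Booleans.

§8(d): uses an L-value-free non-vanishing device: NO.
-/

namespace Summit.Ventures.HodgeRepro2.T6
namespace N41PlaceToy

/-- The sign character of the square classes: `false ↦ 1`, `true ↦ −1`. -/
noncomputable def sgn (b : Bool) : ℂˣ := if b then -1 else 1

/-- `sgn (a && xor c η) = sgn (a && c) · sgn (a && η)` — the toy's Corollary A.5 (1). -/
theorem sgn_and_xor (a c η : Bool) : sgn (a && xor c η) = sgn (a && c) * sgn (a && η) := by
  cases a <;> cases c <;> cases η <;> simp [sgn]

/-- `sgn true = −1`. -/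
theorem sgn_true : sgn true = -1 := by simp [sgn]

/-- `sgn false = 1`. -/
theorem sgn_false : sgn false = 1 := by simp [sgn]

/-- The toy convention-character datum over `toySpIS` (the real place's square classes; see the module
docstring). -/
@[reducible] noncomputable def toyKdIS : KappaDatum toySpIS where
  Fx := fun _ => Bool
  AddCh := fun _ => Bool
  smul := fun _ c η => xor c η
  hilbert := fun _ a c => sgn (a && c)
  γF := fun _ a η => sgn (a && η)
  ϖ := fun _ => true
  ψ := fun _ => false
  t := fun _ => true
  lam := fun _ => -1
  κv := fun _ => -1
  μ₂_eq := fun _ _ _ => by simp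
  γD_def := fun _ _ _ => by simp [sgn_true]

/-- Rao's Corollary A.5 (1) holds on the toy, non-vacuously: `sgn (a && xor c η) = sgn (a && c) · sgn (a && η)`. -/
theorem toyIS_Rao : Hyp.Rao1993_CorA5_1 toyKdIS := fun _ a c η => sgn_and_xor a c η

/-- The residual `hκ'` holds on the toy: `κ_v = −1 = (γF ϖ ψ · (γF ϖ (tψ))⁻¹)⁻¹ = (1 · (−1)⁻¹)⁻¹`. -/
theorem toyIS_kappa' : ∀ v, toySpIS.splitPlace v → v ∉ toyDatumIS.S →
    toyKdIS.κv v = (toyKdIS.κ' v)⁻¹ := fun _ _ _ => by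
  show (-1 : ℂˣ) = (sgn (true && false) * (sgn (true && xor true false))⁻¹)⁻¹
  simp [sgn_true, sgn_false]

/-- `κ_v(ϖ_v) = (ϖ_v, t)_v` on the toy (`−1 = −1`), obtained from `kappa_eq_hilbert`. -/
theorem toyIS_kappa_eq_hilbert : ∀ v, toySpIS.splitPlace v → v ∉ toyDatumIS.S →
    toyKdIS.κv v = toyKdIS.hilbert v (toyKdIS.ϖ v) (toyKdIS.t v) :=
  N41Place.kappa_eq_hilbert toyKdIS toyIS_Rao toyIS_kappa'

/-- (A″κ) on the toy, obtained from `hκ_of_kappa` (not by computing the toy's values). -/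
theorem toyIS_hκ_of_kappa : ∀ v, toySpIS.splitPlace v → v ∉ toyDatumIS.S →
    toyInIS.γD (toySpIS.p₁ v) = toySpIS.μ₂ v :=
  N41Place.hκ_of_kappa toyKdIS toyIS_Rao toyIS_kappa'

/-- **(d) for the placement modulo `hκ'`:** the hypotheses of `N41_placement_kappa` hold jointly on the toy —
all seven displays, the real dichotomy, the residual `hκ'` — and its conclusion is obtained by applying the
theorem. -/
theorem toyIS_placement_kappa :
    ∀ v ∉ toyDatumIS.S, ∀ s : ℂ, toyDatumIS.Lv v s = toyDatumIS.g₁ v s * toyDatumIS.g₂ v s :=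
  N41Place.N41_placement_kappa toyDatumIS toyPlIS toyInIS toySpIS toyLQIS toyKdIS toyIS_LR7 toyIS_Bump
    toyIS_Harris toyIS_Rogawski toyIS_Minguez toyIS_Bump451 toyIS_Rao toyIS_dich toyIS_kappa'

/-- The conclusion at the toy's split place, non-vacuous (`true ∉ ∅`). -/
theorem toyIS_placement_kappa_at_split (s : ℂ) :
    toyDatumIS.Lv true s = toyDatumIS.g₁ true s * toyDatumIS.g₂ true s :=
  toyIS_placement_kappa true (Finset.notMem_empty _) s

end N41PlaceToy
end Summit.Ventures.HodgeRepro2.T6
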